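import Literature.Analysis.Fourier.HilbertTransformCircle
import HarnessLib

/-!
# The periodic Hilbert transform of a trigonometric polynomial

Topic `Literature/Analysis/Fourier`. With the operator `hilbertTransformCircle` of
`Literature/Analysis/Fourier/HilbertTransformCircle.lean` (p.v. cot-kernel form, convention `H sin = −cos`), the multiplier
`−i·sgn k` acts termwise on every real trigonometric polynomial:

  `H[c + Σ_{k=1}^{n} (α_k sin kx + β_k cos kx)] = Σ_{k=1}^{n} (−α_k cos kx + β_k sin kx)`

[cite: Grafakos2014, Ex. 4.1.4(c) (conjugate function of a trigonometric polynomial)]; this is the form in which the certified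
finite Fourier centres of the 1-D model profile certificates (`Summits/NavierStokesRegularity/OSWSelfSimilar/Certificate*.lean`,
sequence-space statements with multiplier `hilbertSymbol`) meet the analytic operator. Proof: induction on `n` with the additivity rule
(the interval-integrability of the symmetric integrand is carried along) and the one-mode identity `hilbertTransformCircle_mode`.
No new definition.
-/

namespace Literature.Analysis.Fourier

open _root_.MeasureTheory Set Filter intervalIntegral
open scoped Real Topology

/-- The real trigonometric polynomial `c + Σ_{k<n} (α k · sin((k+1)y) + β k · cos((k+1)y))` (frequencies `1 … n`). [folklore] -/
private theorem trigPoly_succ (c : ℝ) (α β : ℕ → ℝ) (n : ℕ) :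
    (fun y : ℝ => c + ∑ k ∈ Finset.range (n + 1),
        (α k * Real.sin (((k + 1 : ℕ) : ℝ) * y) + β k * Real.cos (((k + 1 : ℕ) : ℝ) * y))) =
      fun y : ℝ => (c + ∑ k ∈ Finset.range n,
        (α k * Real.sin (((k + 1 : ℕ) : ℝ) * y) + β k * Real.cos (((k + 1 : ℕ) : ℝ) * y)))
        + (α n * Real.sin (((n + 1 : ℕ) : ℝ) * y) + β n * Real.cos (((n + 1 : ℕ) : ℝ) * y)) := by
  funext y
  rw [Finset.sum_range_succ]
  ring

/-- **`H` of a trigonometric polynomial, termwise** — together with the interval-integrability of its symmetric integrand (which the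
additivity rule needs): for every `n`, constant `c` and coefficients `α, β`,
`H[c + Σ_{k<n} (α_k sin((k+1)·) + β_k cos((k+1)·))](x) = Σ_{k<n} (−α_k cos((k+1)x) + β_k sin((k+1)x))`.
[cite: Grafakos2014, Ex. 4.1.4(c) (conjugate function of a trigonometric polynomial)] -/
theorem hilbertTransformCircle_trigPoly (n : ℕ) (c : ℝ) (α β : ℕ → ℝ) (x : ℝ) :
    IntervalIntegrable (fun t => ((c + ∑ k ∈ Finset.range n,
          (α k * Real.sin (((k + 1 : ℕ) : ℝ) * (x - t)) + β k * Real.cos (((k + 1 : ℕ) : ℝ) * (x - t))))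
        - (c + ∑ k ∈ Finset.range n,
          (α k * Real.sin (((k + 1 : ℕ) : ℝ) * (x + t)) + β k * Real.cos (((k + 1 : ℕ) : ℝ) * (x + t)))))
        * (Real.cos (t / 2) / Real.sin (t / 2))) volume 0 π ∧
    hilbertTransformCircle (fun y => c + ∑ k ∈ Finset.range n,
        (α k * Real.sin (((k + 1 : ℕ) : ℝ) * y) + β k * Real.cos (((k + 1 : ℕ) : ℝ) * y))) x =
      ∑ k ∈ Finset.range n, (-α k * Real.cos (((k + 1 : ℕ) : ℝ) * x) + β k * Real.sin (((k + 1 : ℕ) : ℝ) * x)) := by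
  induction n with
  | zero =>
    refine ⟨?_, ?_⟩
    · simp only [Finset.range_zero, Finset.sum_empty, add_zero, sub_self, zero_mul]
      exact intervalIntegrable_const
    · simp only [Finset.range_zero, Finset.sum_empty, add_zero]
      exact hilbertTransformCircle_const c x
  | succ n ih =>
    obtain ⟨ihint, ihval⟩ := ih
    have hk : 1 ≤ n + 1 := by omega
    -- the new mode and the integrability of its symmetric integrand
    have hs := (intervalIntegrable_hilbertCircle_sin (n + 1) hk x).const_mul (α n)
    have hc := (intervalIntegrable_hilbertCircle_cos (n + 1) hk x).const_mul (β n)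
    have hg : IntervalIntegrable (fun t =>
        ((α n * Real.sin (((n + 1 : ℕ) : ℝ) * (x - t)) + β n * Real.cos (((n + 1 : ℕ) : ℝ) * (x - t)))
          - (α n * Real.sin (((n + 1 : ℕ) : ℝ) * (x + t)) + β n * Real.cos (((n + 1 : ℕ) : ℝ) * (x + t))))
          * (Real.cos (t / 2) / Real.sin (t / 2))) volume 0 π := by
      refine (hs.add hc).congr_ae (Eventually.of_forall fun t => ?_)
      show α n * _ + β n * _ = _
      ring
    have hmode := hilbertTransformCircle_mode (n + 1) hk (α n) (β n) x
    have hadd : hilbertTransformCircle (fun y : ℝ => (c + ∑ k ∈ Finset.range n,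
          (α k * Real.sin (((k + 1 : ℕ) : ℝ) * y) + β k * Real.cos (((k + 1 : ℕ) : ℝ) * y)))
          + (α n * Real.sin (((n + 1 : ℕ) : ℝ) * y) + β n * Real.cos (((n + 1 : ℕ) : ℝ) * y))) x =
        hilbertTransformCircle (fun y : ℝ => c + ∑ k ∈ Finset.range n,
          (α k * Real.sin (((k + 1 : ℕ) : ℝ) * y) + β k * Real.cos (((k + 1 : ℕ) : ℝ) * y))) x
        + hilbertTransformCircle (fun y : ℝ => α n * Real.sin (((n + 1 : ℕ) : ℝ) * y)
          + β n * Real.cos (((n + 1 : ℕ) : ℝ) * y)) x :=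
      hilbertTransformCircle_add
        (f := fun y : ℝ => c + ∑ k ∈ Finset.range n,
          (α k * Real.sin (((k + 1 : ℕ) : ℝ) * y) + β k * Real.cos (((k + 1 : ℕ) : ℝ) * y)))
        (g := fun y : ℝ => α n * Real.sin (((n + 1 : ℕ) : ℝ) * y) + β n * Real.cos (((n + 1 : ℕ) : ℝ) * y))
        ihint hg
    refine ⟨?_, ?_⟩
    · refine (ihint.add hg).congr_ae (Eventually.of_forall fun t => ?_)
      show _ + _ = _
      simp only [Finset.sum_range_succ]
      ring
    · rw [trigPoly_succ c α β n, hadd, ihval, hmode, Finset.sum_range_succ]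

/-- The same statement, value only. [cite: Grafakos2014, Ex. 4.1.4(c)] -/
theorem hilbertTransformCircle_trigPoly_eq (n : ℕ) (c : ℝ) (α β : ℕ → ℝ) (x : ℝ) :
    hilbertTransformCircle (fun y => c + ∑ k ∈ Finset.range n,
        (α k * Real.sin (((k + 1 : ℕ) : ℝ) * y) + β k * Real.cos (((k + 1 : ℕ) : ℝ) * y))) x =
      ∑ k ∈ Finset.range n, (-α k * Real.cos (((k + 1 : ℕ) : ℝ) * x) + β k * Real.sin (((k + 1 : ℕ) : ℝ) * x)) :=
  (hilbertTransformCircle_trigPoly n c α β x).2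

/-- Pure sine polynomials (odd trigonometric polynomials — the class of the odd model profiles): `H[Σ_{k<n} b_k sin((k+1)·)](x) =
−Σ_{k<n} b_k cos((k+1)x)`. [cite: Grafakos2014, Ex. 4.1.4(c)] -/
theorem hilbertTransformCircle_sinPoly (n : ℕ) (b : ℕ → ℝ) (x : ℝ) :
    hilbertTransformCircle (fun y => ∑ k ∈ Finset.range n, b k * Real.sin (((k + 1 : ℕ) : ℝ) * y)) x =
      -∑ k ∈ Finset.range n, b k * Real.cos (((k + 1 : ℕ) : ℝ) * x) := by
  have h := hilbertTransformCircle_trigPoly_eq n 0 b (fun _ => 0) x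
  simp only [zero_mul, add_zero, zero_add] at h
  rw [h, ← Finset.sum_neg_distrib]
  refine Finset.sum_congr rfl fun k _ => ?_
  ring

end Literature.Analysis.Fourier
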